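import Literature.Probability.Process.BrownianPair
import Literature.Probability.Process.BrownianTimeReversal
import HarnessLib

/-!
# Two independent Brownian motions: invariance of the law of the pair under time reversal

Trunk T-PROBABILITY (Literature/Probability/Process); two small definitions and theorems, no named
facts. On the pair canonical space `WienerPair` with the law `wienerPair` of two independent
standard Brownian motions (`BrownianPair.lean`), the pair of paths REVERSED AT A FIXED TIME `T`,

  `(pairRev T ω).i (u) = B_{T-u}(ωᵢ) + B_{T ∨ u}(ωᵢ) - 2 B_T(ωᵢ)`  (`= B_{T-u} - B_T` on `[0, T]`),

has again the law of the pair of Brownian paths (`map_pairRev_eq_map_pairPath`,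
`map_pairRev_wienerPair`): each coordinate is a pre-Brownian motion by
`IsPreBrownianReal.reverse` (`BrownianTimeReversal.lean`), pre-Brownian motions with measurable
marginals have a unique law on path space (`IsPreBrownianReal.map_path_eq`), and the two
coordinates stay independent under the product measure. `lintegral_comp_pairRev` is the form
consumed downstream: `E[F(pairRev T)] = E[F(pairPath)]` for measurable `F ≥ 0` — the
probabilistic half of the time-reversal duality of additive-noise SDEs (the reversed noise path
drives the inverse of the pathwise flow, `KineticTheory/ConfinedFlowReversal.lean`).

## References

* D. Revuz, M. Yor, *Continuous Martingales and Brownian Motion* (3rd ed., 1999), Ch. I,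
  Ex. (1.11) (time reversal `B_{T-t} - B_T` is a Brownian motion on `[0, T]`).
* S. Rohde, O. Schramm, *Basic properties of SLE*, Ann. of Math. 161 (2005), Lemma 3.1. [folklore]
-/

noncomputable section

open MeasureTheory ProbabilityTheory Filter Topology Set
open scoped NNReal ENNReal

namespace Literature.Probability.Process

variable {T : ℝ≥0}

/-! ### The reversed paths -/

/-- The continuous Brownian path of a raw path `ω₁`, reversed at time `T`:
`u ↦ B_{T-u}(ω₁) + B_{T ∨ u}(ω₁) - 2 B_T(ω₁)`. [folklore] -/
def revPath (T : ℝ≥0) (ω₁ : ℝ≥0 → ℝ) (u : ℝ≥0) : ℝ :=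
  brownian (T - u) ω₁ + brownian (max T u) ω₁ - 2 * brownian T ω₁

/-- The **pair of Brownian paths reversed at time `T`**. [folklore] -/
def pairRev (T : ℝ≥0) (ω : WienerPair) : WienerPair :=
  (revPath T ω.1, revPath T ω.2)

/-- `pairRev` in product form. [folklore] -/
theorem pairRev_eq_prodMap (T : ℝ≥0) : pairRev T = Prod.map (revPath T) (revPath T) := rfl

/-- On `[0, T]` the reversed path is `B_{T-u} - B_T`. [folklore] -/
theorem revPath_apply_of_le (ω₁ : ℝ≥0 → ℝ) {u : ℝ≥0} (h : u ≤ T) :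
    revPath T ω₁ u = brownian (T - u) ω₁ - brownian T ω₁ :=
  reverse_apply_of_le (B := brownian) h ω₁

/-- The reversed path starts at `0`. [folklore] -/
@[simp] theorem revPath_zero (T : ℝ≥0) (ω₁ : ℝ≥0 → ℝ) : revPath T ω₁ 0 = 0 :=
  reverse_apply_zero brownian T ω₁

/-- The reversed path is continuous. [folklore] -/
theorem continuous_revPath (T : ℝ≥0) (ω₁ : ℝ≥0 → ℝ) : Continuous (revPath T ω₁) :=
  continuous_reverse (B := brownian) (continuous_brownian ω₁) T

/-- The reversed path is a measurable function of the raw path (product σ-algebra). [folklore] -/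
theorem measurable_revPath (T : ℝ≥0) : Measurable (revPath T) :=
  measurable_pi_lambda _ fun u => measurable_reverse measurable_brownian T u

/-- The reversed pair is measurable. [folklore] -/
theorem measurable_pairRev (T : ℝ≥0) : Measurable (pairRev T) := by
  rw [pairRev_eq_prodMap]
  exact (measurable_revPath T).prodMap (measurable_revPath T)

/-- The first reversed path is continuous. [folklore] -/
theorem continuous_pairRev_fst (T : ℝ≥0) (ω : WienerPair) : Continuous (pairRev T ω).1 :=
  continuous_revPath T ω.1

/-- The second reversed path is continuous. [folklore] -/
theorem continuous_pairRev_snd (T : ℝ≥0) (ω : WienerPair) : Continuous (pairRev T ω).2 :=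
  continuous_revPath T ω.2

/-- The reversed paths start at `0`. [folklore] -/
@[simp] theorem pairRev_fst_zero (T : ℝ≥0) (ω : WienerPair) : (pairRev T ω).1 0 = 0 :=
  revPath_zero T ω.1

/-- The reversed paths start at `0`. [folklore] -/
@[simp] theorem pairRev_snd_zero (T : ℝ≥0) (ω : WienerPair) : (pairRev T ω).2 0 = 0 :=
  revPath_zero T ω.2

/-- On `[0, T]`: `(pairRev T ω).1 u = B_{T-u}(ω₁) - B_T(ω₁)`. [folklore] -/
theorem pairRev_fst_apply_of_le (ω : WienerPair) {u : ℝ≥0} (h : u ≤ T) :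
    (pairRev T ω).1 u = brownian (T - u) ω.1 - brownian T ω.1 :=
  revPath_apply_of_le ω.1 h

/-- On `[0, T]`: `(pairRev T ω).2 u = B_{T-u}(ω₂) - B_T(ω₂)`. [folklore] -/
theorem pairRev_snd_apply_of_le (ω : WienerPair) {u : ℝ≥0} (h : u ≤ T) :
    (pairRev T ω).2 u = brownian (T - u) ω.2 - brownian T ω.2 :=
  revPath_apply_of_le ω.2 h

/-! ### The law of the reversed pair -/

/-- **The law of the single reversed path is the law of the single path** (both are
pre-Brownian motions with measurable marginals: `IsPreBrownianReal.reverse` and uniqueness of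
the law on path space). [folklore] -/
theorem map_revPath_eq_map_path (T : ℝ≥0) :
    preWienerMeasure.map (revPath T) =
      preWienerMeasure.map fun (ω₁ : ℝ≥0 → ℝ) (u : ℝ≥0) => brownian u ω₁ :=
  IsPreBrownianReal.map_path_eq (RandomPlanarGeometry.isPreBrownianReal_brownian.reverse T)
    RandomPlanarGeometry.isPreBrownianReal_brownian
    (fun s => measurable_reverse measurable_brownian T s) measurable_brownian

/-- **The reversed pair has the law of the pair of Brownian paths.** [folklore] -/
theorem map_pairRev_eq_map_pairPath (T : ℝ≥0) :
    wienerPair.map (pairRev T) = wienerPair.map pairPath := by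
  haveI := RandomPlanarGeometry.isProbabilityMeasure_preWienerMeasure'
  rw [pairRev_eq_prodMap, pairPath_eq_prodMap, wienerPair,
    ← Measure.map_prod_map _ _ (measurable_revPath T) (measurable_revPath T),
    ← Measure.map_prod_map _ _ measurable_path measurable_path, map_revPath_eq_map_path]

/-- The reversed pair has law `wienerPair`. [folklore] -/
theorem map_pairRev_wienerPair (T : ℝ≥0) : wienerPair.map (pairRev T) = wienerPair := by
  rw [map_pairRev_eq_map_pairPath, map_pairPath_wienerPair]

/-- **Expectations of functionals of the reversed pair**: `E[F(pairRev T)] = E[F(pairPath)]` for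
every measurable `F ≥ 0`. [folklore] -/
theorem lintegral_comp_pairRev {F : WienerPair → ℝ≥0∞} (hF : Measurable F) (T : ℝ≥0) :
    ∫⁻ ω, F (pairRev T ω) ∂wienerPair = ∫⁻ ω, F (pairPath ω) ∂wienerPair := by
  rw [← lintegral_map hF (measurable_pairRev T), map_pairRev_eq_map_pairPath,
    lintegral_map hF measurable_pairPath]

/-- Expectations of real functionals of the reversed pair: `E[F(pairRev T)] = E[F(pairPath)]` for
every (strongly) measurable `F`. [folklore] -/
theorem integral_comp_pairRev {F : WienerPair → ℝ} (hF : AEStronglyMeasurable F wienerPair)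
    (T : ℝ≥0) : ∫ ω, F (pairRev T ω) ∂wienerPair = ∫ ω, F (pairPath ω) ∂wienerPair := by
  have h1 : AEStronglyMeasurable F (wienerPair.map (pairRev T)) := by rwa [map_pairRev_wienerPair]
  have h2 : AEStronglyMeasurable F (wienerPair.map pairPath) := by rwa [map_pairPath_wienerPair]
  rw [← integral_map (measurable_pairRev T).aemeasurable h1, map_pairRev_eq_map_pairPath,
    integral_map measurable_pairPath.aemeasurable h2]

end Literature.Probability.Process
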